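import Literature.NumberTheory.Transcendental.NesterenkoConsecutiveMaxima
import HarnessLib

/-!
# Nesterenko's denominator theorem: the consecutive-maxima `lcm` inclusions (Lemmas 5 and 6)

Topic `Literature/NumberTheory/Transcendental`. [Nesterenko2008, §2] studies the rational
functions
`R(s) = γ ∏_{j=1}^m Γ(s+a_j)/Γ(s+b_j) = ∏_{j=1}^m R_j(s)` (integers `a_j, b_j ≥ 1`; (5), (7)), a
product of POLYNOMIAL bricks `R_j(s) = (b_j+s)(b_j+1+s)⋯(a_j-1+s)/(a_j-b_j)!` (`j ∈ S₁ = {a_j > b_j}`)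
and RECIPROCAL bricks `R_j(s) = (b_j-a_j-1)!/((a_j+s)(a_j+1+s)⋯(b_j-1+s))` (`j ∈ S₂ = {a_j < b_j}`),
with segments `Δ_j = [a_j, b_j - 1]` (`j ∈ S₂`), `𝓜(ℓ) = {j ∈ S₂ : ℓ ∈ Δ_j}`, `d(ℓ) = Card 𝓜(ℓ)`,
the poles `𝒫 = ⋃_{j ∈ S₂} Δ_j`, and the partial-fraction coefficients
`B_{ℓ,k} = (1/(d-k)!) (d/ds)^{d-k} (R(s)(s+ℓ)^d)|_{s=-ℓ}` (`d = d(ℓ)`, `1 ≤ k ≤ d`; (8)), so that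
`R(s) = ∑_{ℓ ∈ 𝒫} ∑_{k=1}^{d(ℓ)} B_{ℓ,k} (s+ℓ)^{-k}` (+ a polynomial) and
`∑_ν R(ν) z^ν`, `∑_ν R^{(r-1)}(ν) z^ν` are linear forms in polylogarithms whose coefficients are
built from the `B_{ℓ,k}` ([Nesterenko2008, Prop. 1]). The DENOMINATORS THEOREM ("Nesterenko's
theorem [Ne3]" of [Zudilin2004, (9.3)], [Zudilin2003, (33)]) clears the `B_{ℓ,k}` by products
`D_{m(1)} D_{m(2)} ⋯` of `D_M = lcm(1,…,M)` over the CONSECUTIVE MAXIMA of explicit multisets of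
parameter differences. This file PROVES (no named facts) the two printed lemmas that carry it:

* `Nesterenko2008.lemma5` — **[Nesterenko2008, Lemma 5]**: for `ℓ ∈ 𝒫`,
  `D_{p(1)} D_{p(2)} ⋯ D_{p(Card S₂ - d(ℓ))} · B_{ℓ,d(ℓ)} ∈ ℤ`, `p(1) ≥ p(2) ≥ ⋯` the consecutive
  maxima of the multiset `{max(b_i - a_j - 1, b_j - a_i - 1) : i ∈ 𝓜(ℓ), j ∈ S₂ ∖ 𝓜(ℓ)}` (12);
* `Nesterenko2008.lemma6` — **[Nesterenko2008, Lemma 6]**: if `|Δ_i| < |Δ_j|` for all `i ∈ S₁`,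
  `j ∈ S₂` (in particular if `S₁ = ∅`), then for `ℓ ∈ 𝒫` and `1 ≤ k ≤ d(ℓ)`,
  `D_{q(1)} D_{q(2)} ⋯ D_{q(Card S₂ - k)} · B_{ℓ,k} ∈ ℤ`, `q(1) ≥ q(2) ≥ ⋯` the consecutive maxima of
  `𝒩₂ = {max(b_i - a_j - 1, b_j - a_i - 1) : i, j ∈ S₂, i < j}` (a multiset with
  `Card S₂ (Card S₂ - 1)/2` places, p. 282).

Here `|Δ|` is the length of the segment (`|Δ_j| = b_j - a_j - 1` for `j ∈ S₂`,
`|Δ_i| = a_i - b_i - 1` for `i ∈ S₁`, p. 282 l. 19), so the hypothesis of Lemma 6 reads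
`a_i - b_i < b_j - a_j`: every numerator block is shorter than every denominator block.
The general Theorem 1 of [Nesterenko2008] (arbitrary `S₁`, a larger multiset `𝒩₁ ∪ 𝒩₂`, and the
constant term `A₀` via `𝒩₃`) is stated on p. 278, which is not available to us, and is NOT
formalised here; Lemma 6 is its case of short numerators and Lemma 5 its top-order case.

Formalisation. The bricks are the tree's `polyBrick b v` (`= R_j` for `j ∈ S₁` with `b = b_j`,
`v = a_j - b_j`) and `recipBrick a w` (`= R_j` for `j ∈ S₂` with `a = a_j`, `w = b_j - a_j ≥ 1`),
indexed by finite types `ι₁` (`S₁`) and `ι₂` (`S₂`) (`Nesterenko2008.BrickProduct`); `B_{ℓ,k}` is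
DEFINED by (8) through the regularisation `Q_ℓ(s) = R(s)(s+ℓ)^{d(ℓ)}` (`recipBrickReg` on
`𝓜(ℓ)`; `Q_eq`); the pair multiset `𝒩₂` is indexed by the 2-element subsets of `ι₂`. Proof as
printed (p. 282): Leibniz over the factors (`isInt_mul_divDeriv_prod`), the brick lemmas
(Lemma 1 = `polyBrick_isDInt`, Lemmas 3–4 = `recipBrick_isDInt_smul` / `recipBrickReg_isDInt_max`
with modulus `max(ℓ - a_j, b_j - 1 - ℓ)`), and the placement of the needed moduli "at different
places in the set 𝒩₂" (`prod_map_lcmUpto_dvd_lcmTop_of_rel`): partners in `𝓜(ℓ)` for the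
denominator bricks (an explicit pair packing, `exists_pair_packing`), arbitrary remaining pairs
for the numerator bricks (counting `Card S₂ - 1 ≤ Card S₂ (Card S₂ - 1)/2`).

## References

* [Nesterenko2008] Yu. V. Nesterenko, *Construction of approximations to zeta-values*, in:
  Diophantine Approximation (Festschrift W. Schmidt), Dev. Math. 16, Springer 2008, 275–293,
  §2: (7), (8) p. 277; Lemmas 1–2 p. 279; Lemmas 5–6 pp. 281–282.
* [Zudilin2004] W. Zudilin, *Arithmetic of linear forms involving odd zeta values*, J. Théor.
  Nombres Bordeaux 16 (2004), 251–291, §9 (9.3) ("Nesterenko's theorem [Ne3]").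
* [Zudilin2003] W. Zudilin, *Well-poised hypergeometric service for diophantine problems of zeta
  values*, J. Théor. Nombres Bordeaux 15 (2003), 593–626, (33).
-/

noncomputable section

open Finset Filter Topology Literature.Analysis.Calculus
open scoped Nat

namespace Literature.NumberTheory.Transcendental

namespace Nesterenko2008

/-! ### Multiset book-keeping (private helpers) -/

/-- `∏` over a sum of multisets. [folklore] -/
private theorem prod_map_sum {γ : Type*} (s : Finset γ) (g : γ → Multiset ℕ) (f : ℕ → ℕ) :
    ((∑ x ∈ s, g x).map f).prod = ∏ x ∈ s, ((g x).map f).prod := by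
  classical
  induction s using Finset.induction_on with
  | empty => simp
  | insert a s ha ih => rw [sum_insert ha, prod_insert ha, Multiset.map_add, Multiset.prod_add, ih]

/-- `card` of a sum of multisets. [folklore] -/
private theorem card_sum {γ : Type*} (s : Finset γ) (g : γ → Multiset ℕ) :
    Multiset.card (∑ x ∈ s, g x) = ∑ x ∈ s, Multiset.card (g x) := by
  classical
  induction s using Finset.induction_on with
  | empty => simp
  | insert a s ha ih => rw [sum_insert ha, sum_insert ha, Multiset.card_add, ih]

/-- `Multiset.Rel` is additive over finite sums. [folklore] -/
private theorem rel_sum {γ : Type*} (s : Finset γ) {c u : γ → Multiset ℕ}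
    (h : ∀ x ∈ s, Multiset.Rel (· ≤ ·) (c x) (u x)) :
    Multiset.Rel (· ≤ ·) (∑ x ∈ s, c x) (∑ x ∈ s, u x) := by
  classical
  induction s using Finset.induction_on with
  | empty => simp
  | insert a s ha ih =>
    rw [sum_insert ha, sum_insert ha]
    exact (h a (mem_insert_self a s)).add (ih fun x hx => h x (mem_insert_of_mem hx))

/-- `map` over a sum of multisets. [folklore] -/
private theorem map_sum' {γ β : Type*} (s : Finset γ) (g : γ → Multiset β) (f : β → ℕ) :
    (∑ x ∈ s, g x).map f = ∑ x ∈ s, (g x).map f := by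
  classical
  induction s using Finset.induction_on with
  | empty => simp
  | insert a s ha ih => rw [sum_insert ha, sum_insert ha, Multiset.map_add, ih]

/-- The underlying multiset of a disjoint indexed union. [folklore] -/
private theorem val_disjiUnion_eq_sum {γ β : Type*} (s : Finset γ) (E : γ → Finset β)
    (h : (s : Set γ).PairwiseDisjoint E) :
    (s.disjiUnion E h).val = ∑ x ∈ s, (E x).val := by
  rw [disjiUnion_val, sum_eq_multiset_sum]
  rfl

variable {ι₁ ι₂ : Type*}

/-! ### The pair packing -/

/-- **Pair packing** (the count "for any `i ∈ 𝓜(ℓ)` the set `𝒩₂` contains `d - 1` elements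
corresponding to `j ∈ 𝓜(ℓ)`, `j ≠ i`", [Nesterenko2008, p. 282], made effective): if
`∑_{i ∈ S} τ_i ≤ Card S - 1` then one can choose, for each `i ∈ S`, `τ_i` two-element subsets of
`S` containing `i`, all distinct. (Induction on `Card S`: some `i₀` has `τ_{i₀} = 0`; pair it
with one unit of demand and remove it.) [cite: Nesterenko2008, §2 proof of Lemma 6 p. 282] -/
theorem exists_pair_packing [DecidableEq ι₂] : ∀ (n : ℕ) (S : Finset ι₂) (τ : ι₂ → ℕ),
    S.card = n → (∑ i ∈ S, τ i) + 1 ≤ S.card →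
    ∃ E : ι₂ → Finset (Finset ι₂),
      (∀ i ∈ S, (E i).card = τ i) ∧
      (∀ i ∈ S, ∀ e ∈ E i, i ∈ e ∧ e ⊆ S ∧ e.card = 2) ∧
      (S : Set ι₂).PairwiseDisjoint E := by
  intro n
  induction n using Nat.strong_induction_on with
  | _ n ih =>
    intro S τ hn hsum
    by_cases hall : ∀ i ∈ S, τ i = 0
    · refine ⟨fun _ => ∅, fun i hi => by simp [hall i hi], fun i _ e he => by simp at he, ?_⟩
      intro i _ j _ _
      simp
    · push Not at hall
      obtain ⟨i₁, hi₁, hτ₁⟩ := hall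
      -- some `i₀ ∈ S` has `τ i₀ = 0`
      have hex : ∃ i₀ ∈ S, τ i₀ = 0 := by
        by_contra hne
        push Not at hne
        have : S.card ≤ ∑ i ∈ S, τ i := by
          rw [card_eq_sum_ones]
          exact sum_le_sum fun i hi => Nat.one_le_iff_ne_zero.2 (hne i hi)
        omega
      obtain ⟨i₀, hi₀, hτ₀⟩ := hex
      have h01 : i₀ ≠ i₁ := by
        rintro rfl
        exact hτ₁ hτ₀
      -- the smaller instance
      set S' := S.erase i₀ with hS'
      set τ' := Function.update τ i₁ (τ i₁ - 1) with hτ'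
      have hi₁' : i₁ ∈ S' := mem_erase.2 ⟨h01.symm, hi₁⟩
      have hcard' : S'.card = n - 1 := by rw [hS', card_erase_of_mem hi₀, hn]
      have hn1 : 1 ≤ n := by rw [← hn]; exact card_pos.2 ⟨i₀, hi₀⟩
      have hsumS' : ∑ i ∈ S', τ i = ∑ i ∈ S, τ i := by
        have := add_sum_erase S τ hi₀
        rw [hτ₀, zero_add] at this
        rw [hS', this]
      have hsum' : (∑ i ∈ S', τ' i) + 1 = ∑ i ∈ S', τ i := by
        rw [hτ', ← insert_erase hi₁', sum_insert (notMem_erase i₁ S'),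
          sum_insert (notMem_erase i₁ S'), Function.update_self]
        have : ∑ x ∈ S'.erase i₁, Function.update τ i₁ (τ i₁ - 1) x = ∑ x ∈ S'.erase i₁, τ x :=
          sum_congr rfl fun x hx => by rw [Function.update_of_ne (ne_of_mem_erase hx)]
        rw [this]
        have := Nat.one_le_iff_ne_zero.2 hτ₁
        omega
      have hhyp' : (∑ i ∈ S', τ' i) + 1 ≤ S'.card := by
        rw [hcard']
        omega
      obtain ⟨E', hE'card, hE'mem, hE'disj⟩ := ih (n - 1) (by omega) S' τ' hcard' hhyp'
      -- the new packing: `E i₁` gets the extra pair `{i₁, i₀}`, `E i₀ = ∅`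
      set e₀ : Finset ι₂ := {i₁, i₀} with he₀
      have he₀E' : ∀ i ∈ S', e₀ ∉ E' i := by
        intro i hi he
        have := (hE'mem i hi e₀ he).2.1 (show i₀ ∈ e₀ by simp [he₀])
        exact (notMem_erase i₀ S) this
      set E : ι₂ → Finset (Finset ι₂) :=
        fun i => if i = i₁ then insert e₀ (E' i₁) else if i = i₀ then ∅ else E' i with hE
      have hEi₁ : E i₁ = insert e₀ (E' i₁) := by rw [hE]; simp
      have hEi₀ : E i₀ = ∅ := by rw [hE]; simp [h01]
      have hEi : ∀ i, i ≠ i₁ → i ≠ i₀ → E i = E' i := fun i h1 h0 => by rw [hE]; simp [h1, h0]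
      have hS'S : S' ⊆ S := erase_subset i₀ S
      refine ⟨E, ?_, ?_, ?_⟩
      · -- cardinalities
        intro i hi
        by_cases hi1 : i = i₁
        · rw [hi1, hEi₁, card_insert_of_notMem (he₀E' i₁ hi₁'), hE'card i₁ hi₁', hτ',
            Function.update_self]
          have := Nat.one_le_iff_ne_zero.2 hτ₁
          omega
        · by_cases hi0 : i = i₀
          · rw [hi0, hEi₀, hτ₀, card_empty]
          · rw [hEi i hi1 hi0, hE'card i (mem_erase.2 ⟨hi0, hi⟩), hτ', Function.update_of_ne hi1]
      · -- shape of the members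
        intro i hi e he
        by_cases hi1 : i = i₁
        · rw [hi1, hEi₁, mem_insert] at he
          rcases he with rfl | he
          · refine ⟨by rw [hi1, he₀]; simp, ?_, by rw [he₀]; exact card_pair h01.symm⟩
            intro x hx
            rw [he₀, mem_insert, mem_singleton] at hx
            rcases hx with rfl | rfl
            · exact hi₁
            · exact hi₀
          · obtain ⟨h1, h2, h3⟩ := hE'mem i₁ hi₁' e he
            exact ⟨hi1 ▸ h1, h2.trans hS'S, h3⟩
        · by_cases hi0 : i = i₀
          · rw [hi0, hEi₀] at he
            simp at he
          · rw [hEi i hi1 hi0] at he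
            obtain ⟨h1, h2, h3⟩ := hE'mem i (mem_erase.2 ⟨hi0, hi⟩) e he
            exact ⟨h1, h2.trans hS'S, h3⟩
      · -- pairwise disjointness
        intro i hi j hj hij
        change Disjoint (E i) (E j)
        by_cases hi0 : i = i₀
        · rw [hi0, hEi₀]
          exact disjoint_bot_left
        by_cases hj0 : j = i₀
        · rw [hj0, hEi₀]
          exact disjoint_bot_right
        have hiS' : i ∈ S' := mem_erase.2 ⟨hi0, hi⟩
        have hjS' : j ∈ S' := mem_erase.2 ⟨hj0, hj⟩
        have hold : Disjoint (E' i) (E' j) := hE'disj hiS' hjS' hij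
        by_cases hi1 : i = i₁
        · have hj1 : j ≠ i₁ := fun h => hij (hi1.trans h.symm)
          rw [hi1, hEi₁, hEi j hj1 hj0, disjoint_insert_left]
          exact ⟨he₀E' j hjS', hi1 ▸ hold⟩
        · rw [hEi i hi1 hi0]
          by_cases hj1 : j = i₁
          · rw [hj1, hEi₁, disjoint_insert_right]
            exact ⟨he₀E' i hiS', hj1 ▸ hold⟩
          · rw [hEi j hj1 hj0]
            exact hold

/-! ### Nesterenko's data -/

/-- The data of Nesterenko's rational function (7) `R(s) = ∏_j R_j(s)`: polynomial bricks
`R_i(s) = (s+b_i)(s+b_i+1)⋯(s+b_i+v_i-1)/v_i!` (`i ∈ S₁ = ι₁`; printed `a_i = b_i + v_i > b_i`,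
the degenerate `v_i = 0`, `R_i = 1` being allowed here) and reciprocal bricks
`R_j(s) = (w_j-1)!/((s+a_j)(s+a_j+1)⋯(s+a_j+w_j-1))` (`j ∈ S₂ = ι₂`; printed `b_j = a_j + w_j > a_j`).
[cite: Nesterenko2008, §2 (5) and (7) p. 276–277] -/
structure BrickProduct (ι₁ ι₂ : Type*) where
  /-- shift `b_i` of the `i`-th polynomial brick -/
  b : ι₁ → ℤ
  /-- degree `v_i = a_i - b_i` of the `i`-th polynomial brick -/
  v : ι₁ → ℕ
  /-- first pole shift `a_j` of the `j`-th reciprocal brick -/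
  a : ι₂ → ℤ
  /-- number of linear factors `w_j = b_j - a_j ≥ 1` of the `j`-th reciprocal brick -/
  w : ι₂ → ℕ
  one_le_w : ∀ j, 1 ≤ w j

namespace BrickProduct

variable (P : BrickProduct ι₁ ι₂)

/-- The element of Nesterenko's sets at a pair `(i, j)` of reciprocal bricks:
`max(b_i - a_j - 1, b_j - a_i - 1)` (`b = a + w`; a natural number, as the two arguments sum to
`|Δ_i| + |Δ_j| ≥ 0`). [cite: Nesterenko2008, §2 (12) p. 281 and p. 282] -/
def pairMax (i j : ι₂) : ℕ :=
  (max (P.a i + P.w i - P.a j - 1) (P.a j + P.w j - P.a i - 1)).toNat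

/-- Symmetry of the pair element. [cite: Nesterenko2008, §2 p. 282] -/
theorem pairMax_comm (i j : ι₂) : P.pairMax i j = P.pairMax j i := by
  unfold pairMax
  rw [max_comm]

/-- Nesterenko's modulus `M = max(ℓ - a_j, b_j - 1 - ℓ)` of the `j`-th reciprocal brick at `-ℓ`
(Lemmas 3–4). [cite: Nesterenko2008, §2 proof of Lemma 5 p. 281] -/
def modulus (ℓ : ℤ) (j : ι₂) : ℕ := (max (ℓ - P.a j) (P.a j + P.w j - 1 - ℓ)).toNat

/-- Under the hypothesis of Lemma 6 (`v_h < w_j` for all `h ∈ S₁`, `j ∈ S₂`), every pair element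
dominates every numerator degree: `v_h ≤ max(b_i - a_j - 1, b_j - a_i - 1)` (p. 282, l. 19–21).
[cite: Nesterenko2008, §2 proof of Lemma 6 p. 282] -/
theorem v_le_pairMax (hΔ : ∀ h j, P.v h < P.w j) (h : ι₁) (i j : ι₂) : P.v h ≤ P.pairMax i j := by
  have h1 := hΔ h i
  have h2 := hΔ h j
  unfold pairMax
  rcases le_total (P.a i + P.w i - P.a j - 1) (P.a j + P.w j - P.a i - 1) with h3 | h3
  · rw [max_eq_right h3]
    omega
  · rw [max_eq_left h3]
    omega

/-- The modulus of each factor of `Q_ℓ` (below): `D_{v_i}` for the polynomial bricks (Lemma 1),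
`D_{M_j}` for the reciprocal ones (Lemmas 3–4). [cite: Nesterenko2008, §2 proof of Lemma 6 p. 282] -/
def fmod (ℓ : ℤ) : ι₁ ⊕ ι₂ → ℕ
  | Sum.inl i => Nat.lcmUpto (P.v i)
  | Sum.inr j => Nat.lcmUpto (P.modulus ℓ j)

/-- The moduli are positive. [cite: Nesterenko2008, §2 proof of Lemma 6 p. 282] -/
theorem fmod_pos (ℓ : ℤ) (x : ι₁ ⊕ ι₂) : 0 < P.fmod ℓ x := by
  rcases x with i | j <;> exact Nat.lcmUpto_pos _

section DecEq

variable [DecidableEq ι₂]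

/-- `pairMax` as a function of the unordered pair `{i, j}` (for the indexing of `𝒩₂` by
2-element subsets). [cite: Nesterenko2008, §2 p. 282] -/
def pairVal (e : Finset ι₂) : ℕ := e.sup fun i => e.sup fun j => if i = j then 0 else P.pairMax i j

/-- Lower bound of `pairVal` by the pair elements. [cite: Nesterenko2008, §2 p. 282] -/
theorem pairMax_le_pairVal {e : Finset ι₂} {i j : ι₂} (hi : i ∈ e) (hj : j ∈ e) (hij : i ≠ j) :
    P.pairMax i j ≤ P.pairVal e := by
  unfold pairVal
  refine le_trans ?_ (le_sup (f := fun i => e.sup fun j => if i = j then 0 else P.pairMax i j) hi)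
  refine le_trans ?_ (le_sup (f := fun j => if i = j then 0 else P.pairMax i j) hj)
  simp [hij]

/-- On a genuine pair, `pairVal {i, j} = max(b_i - a_j - 1, b_j - a_i - 1)`.
[cite: Nesterenko2008, §2 p. 282] -/
theorem pairVal_pair {i j : ι₂} (hij : i ≠ j) : P.pairVal {i, j} = P.pairMax i j := by
  refine le_antisymm ?_ (P.pairMax_le_pairVal (by simp) (by simp) hij)
  unfold pairVal
  refine Finset.sup_le fun x hx => Finset.sup_le fun y hy => ?_
  simp only [mem_insert, mem_singleton] at hx hy
  rcases hx with hx | hx <;> rcases hy with hy | hy <;> rw [hx, hy]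
  · simp
  · simp [hij]
  · simp [hij.symm, P.pairMax_comm j i]
  · simp

end DecEq

section Fin₂

variable [Fintype ι₂]

/-- `𝓜(ℓ) = {j ∈ S₂ : ℓ ∈ Δ_j}`, `Δ_j = [a_j, b_j - 1] = [a_j, a_j + w_j - 1]`.
[cite: Nesterenko2008, §2 p. 277] -/
def M (ℓ : ℤ) : Finset ι₂ := univ.filter fun j => P.a j ≤ ℓ ∧ ℓ < P.a j + P.w j

/-- `d(ℓ) = Card 𝓜(ℓ)` (the order of the pole of `R` at `-ℓ`; `ℓ ∈ 𝒫 ↔ d(ℓ) ≥ 1`).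
[cite: Nesterenko2008, §2 p. 277] -/
def d (ℓ : ℤ) : ℕ := (P.M ℓ).card

/-- Membership in `𝓜(ℓ)`. [cite: Nesterenko2008, §2 p. 277] -/
theorem mem_M {ℓ : ℤ} {j : ι₂} : j ∈ P.M ℓ ↔ P.a j ≤ ℓ ∧ ℓ < P.a j + P.w j := by
  simp [M]

/-- For `i` with `ℓ ∈ Δ_i` and any `j`:
`max(ℓ - a_j, b_j - 1 - ℓ) ≤ max(b_i - a_j - 1, b_j - a_i - 1)` (p. 282, l. 12–13).
[cite: Nesterenko2008, §2 proof of Lemma 6 p. 282] -/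
theorem modulus_le_pairMax {ℓ : ℤ} {i : ι₂} (hi : i ∈ P.M ℓ) (j : ι₂) :
    P.modulus ℓ j ≤ P.pairMax i j := by
  rw [mem_M] at hi
  unfold modulus pairMax
  apply Int.toNat_le_toNat
  rcases le_total (ℓ - P.a j) (P.a j + P.w j - 1 - ℓ) with h | h
  · rw [max_eq_right h]
    exact le_max_of_le_right (by omega)
  · rw [max_eq_left h]
    exact le_max_of_le_left (by omega)

variable [DecidableEq ι₂]

/-- **Nesterenko's multiset `𝒩₂`** `= {max(b_i - a_j - 1, b_j - a_i - 1) : i, j ∈ S₂, i < j}`,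
indexed here by the 2-element subsets `{i, j}` of `S₂` (`Card S₂ (Card S₂ - 1)/2` places).
[cite: Nesterenko2008, §2 Lemma 6 p. 281–282] -/
def N2 : Multiset ℕ := ((univ : Finset ι₂).powersetCard 2).val.map P.pairVal

/-- The multiset (12) of **[Nesterenko2008, Lemma 5]**:
`{max(b_i - a_j - 1, b_j - a_i - 1) : i ∈ 𝓜(ℓ), j ∈ S₂ ∖ 𝓜(ℓ)}`.
[cite: Nesterenko2008, §2 Lemma 5 (12) p. 281] -/
def N5 (ℓ : ℤ) : Multiset ℕ := (P.M ℓ ×ˢ (P.M ℓ)ᶜ).val.map fun p => P.pairMax p.1 p.2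

/-- A sub-multiset of `𝒩₂` from a set of pairs. [cite: Nesterenko2008, §2 proof of Lemma 6 p. 282] -/
theorem map_pairVal_le_N2 {E : Finset (Finset ι₂)} (hE : ∀ e ∈ E, e.card = 2) :
    E.val.map P.pairVal ≤ P.N2 := by
  unfold N2
  refine Multiset.map_le_map (val_le_iff.2 fun e he => ?_)
  rw [mem_powersetCard]
  exact ⟨subset_univ e, hE e he⟩

/-- The constant `C = ∏_{j ∉ 𝓜(ℓ)} D_{M_j}` absorbed into the rescaled factors.
[cite: Nesterenko2008, §2 proof of Lemma 6 p. 282] -/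
def C (ℓ : ℤ) : ℕ := ∏ j ∈ (P.M ℓ)ᶜ, Nat.lcmUpto (P.modulus ℓ j)

/-- `C > 0`. [cite: Nesterenko2008, §2 proof of Lemma 6 p. 282] -/
theorem C_pos (ℓ : ℤ) : 0 < P.C ℓ := prod_pos fun _ _ => Nat.lcmUpto_pos _

/-- The factors of `Q_ℓ` indexed by `S₁ ⊕ S₂`: the polynomial bricks, the regularised bricks
`R_j(s)(s+ℓ)` (`j ∈ 𝓜(ℓ)`), and the rescaled regular bricks `D_{M_j} R_j(s)` (`j ∉ 𝓜(ℓ)`).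
[cite: Nesterenko2008, §2 proof of Lemma 6 p. 282] -/
def factor (ℓ : ℤ) : ι₁ ⊕ ι₂ → ℚ → ℚ
  | Sum.inl i => polyBrick (P.b i) (P.v i)
  | Sum.inr j => if j ∈ P.M ℓ then recipBrickReg (P.a j) (P.w j) ℓ
      else fun t => (Nat.lcmUpto (P.modulus ℓ j) : ℚ) * recipBrick (P.a j) (P.w j) t

/-- Lemmas 1, 3, 4 of [Nesterenko2008]: every factor of `Q_ℓ` satisfies `IsDInt` with its modulus
at `-ℓ`. [cite: Nesterenko2008, §2 Lemmas 1, 3, 4 pp. 279–281] -/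
theorem factor_isDInt (ℓ : ℤ) (N : ℕ) (x : ι₁ ⊕ ι₂) :
    IsDInt (P.fmod ℓ x) N (P.factor ℓ x) (-(ℓ : ℚ)) := by
  rcases x with i | j
  · exact polyBrick_isDInt_neg (P.b i) (P.v i) ℓ N
  · by_cases hj : j ∈ P.M ℓ
    · simp only [factor, fmod, if_pos hj]
      exact recipBrickReg_isDInt_max (P.a j) (P.one_le_w j) ℓ N
    · simp only [factor, fmod, if_neg hj]
      have hj' : ℓ < P.a j ∨ P.a j + P.w j ≤ ℓ := by
        rw [mem_M] at hj
        omega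
      exact recipBrick_isDInt_smul (P.a j) (P.one_le_w j) ℓ hj' N

variable [Fintype ι₁]

/-- `R(s) = ∏_{i ∈ S₁} R_i(s) · ∏_{j ∈ S₂} R_j(s)` (7). [cite: Nesterenko2008, §2 (7) p. 277] -/
def R (t : ℚ) : ℚ :=
  (∏ i, polyBrick (P.b i) (P.v i) t) * ∏ j, recipBrick (P.a j) (P.w j) t

/-- The regularised function `Q_ℓ(s) = R(s)(s+ℓ)^{d(ℓ)}`: the factor `s + ℓ` is distributed to
the `d(ℓ)` reciprocal bricks with a pole at `-ℓ` (`recipBrickReg`), so that `Q_ℓ` is a product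
of functions regular at `-ℓ`. [cite: Nesterenko2008, §2 (8) p. 277 and proof of Lemma 6 p. 282] -/
def Q (ℓ : ℤ) (t : ℚ) : ℚ :=
  (∏ i, polyBrick (P.b i) (P.v i) t) *
    ((∏ j ∈ P.M ℓ, recipBrickReg (P.a j) (P.w j) ℓ t) *
      ∏ j ∈ (P.M ℓ)ᶜ, recipBrick (P.a j) (P.w j) t)

/-- Away from `s = -ℓ`: `Q_ℓ(s) = R(s)(s+ℓ)^{d(ℓ)}`. [cite: Nesterenko2008, §2 (8) p. 277] -/
theorem Q_eq (ℓ : ℤ) {t : ℚ} (ht : t + ℓ ≠ 0) : P.Q ℓ t = P.R t * (t + ℓ) ^ P.d ℓ := by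
  unfold Q R d
  have h1 : ∏ j ∈ P.M ℓ, recipBrickReg (P.a j) (P.w j) ℓ t =
      (∏ j ∈ P.M ℓ, recipBrick (P.a j) (P.w j) t) * (t + ℓ) ^ (P.M ℓ).card := by
    rw [← prod_const, ← prod_mul_distrib]
    exact prod_congr rfl fun j _ => recipBrickReg_eq (P.a j) (P.w j) ℓ ht
  rw [h1, ← prod_mul_prod_compl (P.M ℓ) fun j => recipBrick (P.a j) (P.w j) t]
  ring

/-- **The partial-fraction coefficient** `B_{ℓ,k} = (1/(d-k)!) (d/ds)^{d-k}(R(s)(s+ℓ)^d)|_{s=-ℓ}`,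
`d = d(ℓ)`, DEFINED by the printed formula (8) (as the divided derivative of the regularisation
`Q_ℓ`). [cite: Nesterenko2008, §2 (8) p. 277] -/
def B (ℓ : ℤ) (k : ℕ) : ℚ := divDeriv (P.d ℓ - k) (P.Q ℓ) (-(ℓ : ℚ))

/-- `Q_ℓ = C⁻¹ · ∏_x factor_x`. [cite: Nesterenko2008, §2 proof of Lemma 6 p. 282] -/
theorem Q_eq_prod_factor (ℓ : ℤ) (t : ℚ) :
    P.Q ℓ t = ((P.C ℓ : ℚ))⁻¹ * ∏ x, P.factor ℓ x t := by
  have hC : (P.C ℓ : ℚ) ≠ 0 := by exact_mod_cast (P.C_pos ℓ).ne'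
  rw [Fintype.prod_sum_type]
  have h1 : ∏ j ∈ P.M ℓ, P.factor ℓ (Sum.inr j) t = ∏ j ∈ P.M ℓ, recipBrickReg (P.a j) (P.w j) ℓ t :=
    prod_congr rfl fun j hj => by simp only [factor, if_pos hj]
  have h2 : ∏ j ∈ (P.M ℓ)ᶜ, P.factor ℓ (Sum.inr j) t =
      (P.C ℓ : ℚ) * ∏ j ∈ (P.M ℓ)ᶜ, recipBrick (P.a j) (P.w j) t := by
    rw [C, Nat.cast_prod, ← prod_mul_distrib]
    exact prod_congr rfl fun j hj => by simp only [factor, if_neg (mem_compl.1 hj)]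
  rw [← prod_mul_prod_compl (P.M ℓ) fun j => P.factor ℓ (Sum.inr j) t, h1, h2, Q]
  simp only [factor]
  field_simp

/-- `B_{ℓ,k} = C⁻¹ · 𝒟_{d-k}(∏_x factor_x)(-ℓ)`. [cite: Nesterenko2008, §2 proof of Lemma 6 p. 282] -/
theorem B_eq (ℓ : ℤ) (k : ℕ) :
    P.B ℓ k = ((P.C ℓ : ℚ))⁻¹ * divDeriv (P.d ℓ - k) (fun t => ∏ x, P.factor ℓ x t) (-(ℓ : ℚ)) := by
  rw [B, ← divDeriv_const_mul]
  congr 1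
  funext t
  exact P.Q_eq_prod_factor ℓ t

/-- The arithmetic core: if `L` is a multiple of `C · ∏_x fmod_x^{τ_x}` for every exponent vector
`τ` with `∑ τ_x ≤ d(ℓ) - k`, then `L · B_{ℓ,k} ∈ ℤ` (multi-modulus Leibniz rule and the brick
lemmas). [cite: Nesterenko2008, §2 proof of Lemma 6 p. 282] -/
theorem isInt_mul_B [DecidableEq ι₁] (ℓ : ℤ) (k : ℕ) (L : ℕ)
    (hL : ∀ τ : ι₁ ⊕ ι₂ → ℕ, (∑ x, τ x) ≤ P.d ℓ - k →
      P.C ℓ * ∏ x, P.fmod ℓ x ^ τ x ∣ L) :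
    ∃ z : ℤ, (L : ℚ) * P.B ℓ k = z := by
  -- `C ∣ L`
  have hCL : P.C ℓ ∣ L := by
    have := hL (fun _ => 0) (by simp)
    simpa using this
  obtain ⟨L', hL'⟩ := hCL
  have hC : (P.C ℓ : ℚ) ≠ 0 := by exact_mod_cast (P.C_pos ℓ).ne'
  have hmain := isInt_mul_divDeriv_prod (univ : Finset (ι₁ ⊕ ι₂)) (T := P.d ℓ - k)
    (fun x _ => P.fmod_pos ℓ x) (fun x _ => P.factor_isDInt ℓ (P.d ℓ - k) x) (P.d ℓ - k) le_rfl L'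
    (fun τ hτ => by
      have h1 := hL τ hτ
      rw [hL'] at h1
      exact Nat.dvd_of_mul_dvd_mul_left (P.C_pos ℓ) h1)
  obtain ⟨z, hz⟩ := hmain
  refine ⟨z, ?_⟩
  rw [← hz, B_eq, hL']
  push_cast
  field_simp

/-! ### Lemma 5 -/

omit [DecidableEq ι₂] in
/-- `n - 1 ≤ n(n-1)/2` (p. 282: `Card S₂ (Card S₂ - 1)/2 ≥ Card S₂ - 1`). [folklore] -/
private theorem sub_one_le_choose_two : ∀ n : ℕ, n - 1 ≤ n.choose 2
  | 0 => by simp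
  | n + 1 => by
      rw [Nat.choose_succ_succ, Nat.choose_one_right]
      omega

/-- **[Nesterenko2008, Lemma 5].** For every `ℓ ∈ 𝒫` (i.e. `d(ℓ) ≥ 1`):
`D_{p(1)} D_{p(2)} ⋯ D_{p(Card S₂ - d(ℓ))} · B_{ℓ,d(ℓ)} ∈ ℤ`, where `p(1) ≥ p(2) ≥ ⋯` are the
consecutive maxima of the multiset `{max(b_i - a_j - 1, b_j - a_i - 1) : i ∈ 𝓜(ℓ), j ∈ S₂ ∖ 𝓜(ℓ)}`
(12). (Proof as printed: `B_{ℓ,d} = ∏_j Q_j(-ℓ)` with `R_j(-ℓ) ∈ ℤ` (`j ∈ S₁`),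
`R_j(s)(s+ℓ)|_{-ℓ} ∈ ℤ` (`j ∈ 𝓜(ℓ)`), `D_M R_j(-ℓ) ∈ ℤ`, `M = max(ℓ - a_j, b_j - 1 - ℓ)`
(`j ∉ 𝓜(ℓ)`), and `M ≤ max(b_j - a_1 - 1, b_1 - a_j - 1)` for a fixed `1 ∈ 𝓜(ℓ)`, these
`Card S₂ - d(ℓ)` elements standing at different places of (12).)
[cite: Nesterenko2008, §2 Lemma 5 p. 281] -/
theorem lemma5 [DecidableEq ι₁] (ℓ : ℤ) (hℓ : 1 ≤ P.d ℓ) :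
    ∃ z : ℤ, (lcmTop (P.N5 ℓ) (Fintype.card ι₂ - P.d ℓ) : ℚ) * P.B ℓ (P.d ℓ) = z := by
  apply P.isInt_mul_B
  intro τ hτ
  rw [Nat.sub_self, Nat.le_zero, sum_eq_zero_iff] at hτ
  have hτ0 : ∀ x, τ x = 0 := fun x => hτ x (mem_univ x)
  simp only [hτ0, pow_zero, prod_const_one, mul_one]
  obtain ⟨i₀, hi₀⟩ : (P.M ℓ).Nonempty := card_pos.1 hℓ
  -- the needed moduli and their places in (12)
  set c : Multiset ℕ := ((P.M ℓ)ᶜ).val.map (P.modulus ℓ) with hc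
  have hrel : Multiset.Rel (· ≤ ·) c (((P.M ℓ)ᶜ).val.map (P.pairMax i₀)) := by
    rw [hc, Multiset.rel_map]
    exact Multiset.rel_refl_of_refl_on fun j _ => P.modulus_le_pairMax hi₀ j
  have hle : ((P.M ℓ)ᶜ).val.map (P.pairMax i₀) ≤ P.N5 ℓ := by
    have h1 : (({i₀} : Finset ι₂) ×ˢ (P.M ℓ)ᶜ).val =
        ((P.M ℓ)ᶜ).val.map (Prod.mk i₀) := by
      rw [singleton_product]
      rfl
    have h2 : ((P.M ℓ)ᶜ).val.map (P.pairMax i₀) =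
        (({i₀} : Finset ι₂) ×ˢ (P.M ℓ)ᶜ).val.map (fun p => P.pairMax p.1 p.2) := by
      rw [h1, Multiset.map_map]
      rfl
    rw [h2, N5]
    exact Multiset.map_le_map (val_le_iff.2 (product_subset_product_left
      (singleton_subset_iff.2 hi₀)))
  have hdvd := prod_map_lcmUpto_dvd_lcmTop_of_rel hrel hle
  have hcard : Multiset.card c = Fintype.card ι₂ - P.d ℓ := by
    rw [hc, Multiset.card_map, card_val, card_compl, d]
  have hC : P.C ℓ = (c.map Nat.lcmUpto).prod := by
    rw [C, hc, Multiset.map_map, prod_eq_multiset_prod]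
    rfl
  rw [hC, ← hcard]
  exact hdvd

/-! ### Lemma 6 -/

/-- **[Nesterenko2008, Lemma 6].** Suppose `|Δ_i| < |Δ_j|` for all `i ∈ S₁`, `j ∈ S₂`, i.e.
`a_i - b_i < b_j - a_j` (every polynomial brick has fewer than `b_j - a_j` linear factors; the
case `S₁ = ∅` is included). Then for every `ℓ ∈ 𝒫` and `1 ≤ k ≤ d = d(ℓ)`:
`D_{q(1)} D_{q(2)} ⋯ D_{q(Card S₂ - k)} · B_{ℓ,k} ∈ ℤ`, where `q(1) ≥ q(2) ≥ ⋯` are the consecutive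
maxima of the multiset `𝒩₂ = {max(b_i - a_j - 1, b_j - a_i - 1) : i, j ∈ S₂, i < j}`.
(Proof as printed, p. 282: expand `B_{ℓ,k}` by Leibniz over the factors `Q_j` with
`t_1 + ⋯ + t_m = d - k`; a factor needs `t_j` (`j ∈ S₁ ∪ 𝓜(ℓ)`) resp. `t_j + 1` (`j ∈ S₂ ∖ 𝓜(ℓ)`)
copies of its modulus, `Card S₂ - k` in all, and these are dominated by distinct places of
`𝒩₂`: pairs `{i, j}` with `j ∈ 𝓜(ℓ)` for `i ∈ S₂`, arbitrary pairs for `i ∈ S₁`.)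
[cite: Nesterenko2008, §2 Lemma 6 p. 281–282] -/
theorem lemma6 [DecidableEq ι₁] (hΔ : ∀ i j, P.v i < P.w j) (ℓ : ℤ) (k : ℕ) (hk : 1 ≤ k)
    (hkd : k ≤ P.d ℓ) :
    ∃ z : ℤ, (lcmTop P.N2 (Fintype.card ι₂ - k) : ℚ) * P.B ℓ k = z := by
  apply P.isInt_mul_B
  intro τ hτ
  -- notation and the basic counts
  have hsplit : ∑ x, τ x = ∑ i, τ (Sum.inl i) + ∑ j, τ (Sum.inr j) := Fintype.sum_sum_type τ
  have hdle : P.d ℓ ≤ Fintype.card ι₂ := card_le_univ _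
  have hsumM : ∑ j ∈ P.M ℓ, τ (Sum.inr j) ≤ ∑ j, τ (Sum.inr j) :=
    sum_le_sum_of_subset_of_nonneg (subset_univ _) fun _ _ _ => Nat.zero_le _
  have hτj : ∀ j, τ (Sum.inr j) ≤ P.d ℓ - k := fun j =>
    le_trans (single_le_sum (f := τ) (fun _ _ => Nat.zero_le _) (mem_univ (Sum.inr j))) hτ
  -- (a) the pair packing inside `𝓜(ℓ)`
  obtain ⟨E₂, hE₂card, hE₂mem, hE₂disj⟩ := exists_pair_packing (P.M ℓ).card (P.M ℓ)
    (fun j => τ (Sum.inr j)) rfl (by rw [← d]; omega)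
  -- (b) partners in `𝓜(ℓ)` for the bricks outside `𝓜(ℓ)`
  have hT : ∀ j : ι₂, ∃ T : Finset ι₂, T ⊆ P.M ℓ ∧ T.card = τ (Sum.inr j) + 1 := fun j =>
    exists_subset_card_eq (by rw [← d]; have := hτj j; omega)
  choose T hTsub hTcard using hT
  set Epair : ι₂ → Finset (Finset ι₂) :=
    fun j => if j ∈ P.M ℓ then E₂ j else (T j).image fun m => ({j, m} : Finset ι₂) with hEpair
  -- members of `Epair j` are 2-sets containing `j` and an element of `𝓜(ℓ)` other than `j`
  have hmem : ∀ j, ∀ e ∈ Epair j, e.card = 2 ∧ j ∈ e ∧ ∃ m ∈ e, m ≠ j ∧ m ∈ P.M ℓ := by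
    intro j e he
    by_cases hj : j ∈ P.M ℓ
    · rw [hEpair] at he
      simp only [if_pos hj] at he
      obtain ⟨h1, h2, h3⟩ := hE₂mem j hj e he
      obtain ⟨x, y, hxy, rfl⟩ := card_eq_two.1 h3
      refine ⟨h3, h1, ?_⟩
      simp only [mem_insert, mem_singleton] at h1
      rcases h1 with rfl | rfl
      · exact ⟨y, by simp, hxy.symm, h2 (by simp)⟩
      · exact ⟨x, by simp, hxy, h2 (by simp)⟩
    · rw [hEpair] at he
      simp only [if_neg hj, mem_image] at he
      obtain ⟨m, hm, rfl⟩ := he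
      have hmM : m ∈ P.M ℓ := hTsub j hm
      have hmj : m ≠ j := fun h => hj (h ▸ hmM)
      exact ⟨card_pair hmj.symm, by simp, m, by simp, hmj, hmM⟩
  have hcard2 : ∀ j, ∀ e ∈ Epair j, e.card = 2 := fun j e he => (hmem j e he).1
  -- the moduli are dominated
  have hdom : ∀ j, ∀ e ∈ Epair j, P.modulus ℓ j ≤ P.pairVal e := by
    intro j e he
    obtain ⟨_, hje, m, hme, hmj, hmM⟩ := hmem j e he
    exact (P.modulus_le_pairMax hmM j).trans (P.pairMax_le_pairVal hme hje hmj)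
  -- cardinalities of the `Epair j`
  have hEcard : ∀ j, (Epair j).card = τ (Sum.inr j) + (if j ∈ P.M ℓ then 0 else 1) := by
    intro j
    by_cases hj : j ∈ P.M ℓ
    · rw [hEpair]
      simp only [if_pos hj, add_zero]
      exact hE₂card j hj
    · rw [hEpair]
      simp only [if_neg hj]
      rw [card_image_of_injOn, hTcard j]
      intro m hm m' hm' h
      have h' : ({j, m} : Finset ι₂) = {j, m'} := h
      have hmj : m' ≠ j := fun h'' => hj (h'' ▸ hTsub j hm')
      have : m' ∈ ({j, m} : Finset ι₂) := by rw [h']; simp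
      simp only [mem_insert, mem_singleton] at this
      rcases this with h' | h'
      · exact (hmj h').elim
      · exact h'.symm
  -- pairwise disjointness of the `Epair j`
  have hdisj : ((univ : Finset ι₂) : Set ι₂).PairwiseDisjoint Epair := by
    intro j _ j' _ hjj'
    change Disjoint (Epair j) (Epair j')
    rw [disjoint_left]
    intro e he he'
    by_cases hj : j ∈ P.M ℓ
    · by_cases hj' : j' ∈ P.M ℓ
      · have := hE₂disj hj hj' hjj'
        change Disjoint (E₂ j) (E₂ j') at this
        rw [hEpair] at he he'
        simp only [if_pos hj, if_pos hj'] at he he'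
        exact disjoint_left.1 this he he'
      · have h1 : e ⊆ P.M ℓ := by
          rw [hEpair] at he
          simp only [if_pos hj] at he
          exact (hE₂mem j hj e he).2.1
        exact hj' (h1 (hmem j' e he').2.1)
    · have hje : j ∈ e := (hmem j e he).2.1
      by_cases hj' : j' ∈ P.M ℓ
      · have h1 : e ⊆ P.M ℓ := by
          rw [hEpair] at he'
          simp only [if_pos hj'] at he'
          exact (hE₂mem j' hj' e he').2.1
        exact hj (h1 hje)
      · rw [hEpair] at he'
        simp only [if_neg hj', mem_image] at he'
        obtain ⟨m', hm', rfl⟩ := he'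
        simp only [mem_insert, mem_singleton] at hje
        rcases hje with h | h
        · exact hjj' h
        · exact hj (h ▸ hTsub j' hm')
  set U : Finset (Finset ι₂) := (univ : Finset ι₂).disjiUnion Epair hdisj with hU
  have hUsub : U ⊆ (univ : Finset ι₂).powersetCard 2 := by
    intro e he
    rw [hU, mem_disjiUnion] at he
    obtain ⟨j, _, he⟩ := he
    rw [mem_powersetCard]
    exact ⟨subset_univ e, hcard2 j e he⟩
  have hUcard : U.card = ∑ j, (τ (Sum.inr j) + (if j ∈ P.M ℓ then 0 else 1)) := by
    rw [hU, card_disjiUnion]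
    exact sum_congr rfl fun j _ => hEcard j
  have hind : ∑ j, (if j ∈ P.M ℓ then 0 else 1 : ℕ) = Fintype.card ι₂ - P.d ℓ := by
    rw [← sum_add_sum_compl (P.M ℓ), sum_eq_zero fun j hj => if_pos hj,
      sum_congr rfl fun j hj => if_neg (mem_compl.1 hj), sum_const, smul_eq_mul, mul_one,
      card_compl, d, zero_add]
  -- (c) the remaining pairs for the numerator bricks
  have hcount : ∑ i, τ (Sum.inl i) ≤ (((univ : Finset ι₂).powersetCard 2) \ U).card := by
    rw [card_sdiff_of_subset hUsub, card_powersetCard, card_univ, hUcard, sum_add_distrib, hind]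
    have := sub_one_le_choose_two (Fintype.card ι₂)
    omega
  obtain ⟨E₃, hE₃sub, hE₃card⟩ := exists_subset_card_eq hcount
  have hE₃two : ∀ e ∈ E₃, e.card = 2 := fun e he =>
    (mem_powersetCard.1 (mem_sdiff.1 (hE₃sub he)).1).2
  have hdisj₃ : Disjoint U E₃ :=
    disjoint_left.2 fun e he he₃ => (mem_sdiff.1 (hE₃sub he₃)).2 he
  -- the needed moduli `c` and their places `u`
  set n : ι₂ → ℕ := fun j => τ (Sum.inr j) + (if j ∈ P.M ℓ then 0 else 1) with hn
  set c₁ : Multiset ℕ := ∑ j, Multiset.replicate (n j) (P.modulus ℓ j) with hc₁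
  set c₃ : Multiset ℕ := ∑ i, Multiset.replicate (τ (Sum.inl i)) (P.v i) with hc₃
  set u₁ : Multiset ℕ := ∑ j, (Epair j).val.map P.pairVal with hu₁
  set u₃ : Multiset ℕ := E₃.val.map P.pairVal with hu₃
  have hrel₁ : Multiset.Rel (· ≤ ·) c₁ u₁ := by
    rw [hc₁, hu₁]
    refine rel_sum _ fun j _ => Multiset.rel_replicate_left.2 ⟨?_, fun y hy => ?_⟩
    · rw [Multiset.card_map, card_val, hEcard j]
    · obtain ⟨e, he, rfl⟩ := Multiset.mem_map.1 hy
      exact hdom j e he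
  have hrel₃ : Multiset.Rel (· ≤ ·) c₃ u₃ := by
    refine Multiset.rel_of_forall (fun x y hx hy => ?_) ?_
    · rw [hc₃, Multiset.mem_sum] at hx
      obtain ⟨i, _, hx⟩ := hx
      rw [Multiset.eq_of_mem_replicate hx]
      obtain ⟨e, he, rfl⟩ := Multiset.mem_map.1 hy
      obtain ⟨x', y', hxy, rfl⟩ := card_eq_two.1 (hE₃two e he)
      exact (P.v_le_pairMax hΔ i x' y').trans (P.pairMax_le_pairVal (by simp) (by simp) hxy)
    · rw [hc₃, card_sum, hu₃, Multiset.card_map, card_val, hE₃card]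
      exact sum_congr rfl fun i _ => Multiset.card_replicate _ _
  have hrel : Multiset.Rel (· ≤ ·) (c₁ + c₃) (u₁ + u₃) := hrel₁.add hrel₃
  have hle : u₁ + u₃ ≤ P.N2 := by
    have h1 : u₁ + u₃ = (U.disjUnion E₃ hdisj₃).val.map P.pairVal := by
      rw [disjUnion_val, Multiset.map_add, hU, val_disjiUnion_eq_sum, map_sum']
    rw [h1]
    refine P.map_pairVal_le_N2 fun e he => ?_
    rw [mem_disjUnion] at he
    rcases he with he | he
    · exact (mem_powersetCard.1 (hUsub he)).2
    · exact hE₃two e he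
  have hdvd := prod_map_lcmUpto_dvd_lcmTop_of_rel hrel hle
  -- `card (c₁ + c₃) ≤ Card S₂ - k`
  have hcardc : Multiset.card (c₁ + c₃) ≤ Fintype.card ι₂ - k := by
    rw [Multiset.card_add, hc₁, hc₃, card_sum, card_sum]
    simp only [Multiset.card_replicate]
    rw [hn]
    simp only
    rw [sum_add_distrib, hind]
    omega
  -- `C · ∏ fmod^τ = ∏_{x ∈ c₁ + c₃} D_x`
  have hprod : P.C ℓ * ∏ x, P.fmod ℓ x ^ τ x = ((c₁ + c₃).map Nat.lcmUpto).prod := by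
    rw [Multiset.map_add, Multiset.prod_add, hc₁, hc₃, prod_map_sum, prod_map_sum,
      Fintype.prod_sum_type]
    simp only [Multiset.map_replicate, Multiset.prod_replicate, fmod]
    have h1 : ∏ j, Nat.lcmUpto (P.modulus ℓ j) ^ n j =
        (∏ j, Nat.lcmUpto (P.modulus ℓ j) ^ τ (Sum.inr j)) * P.C ℓ := by
      rw [C, ← prod_mul_prod_compl (P.M ℓ) fun j => Nat.lcmUpto (P.modulus ℓ j) ^ n j,
        ← prod_mul_prod_compl (P.M ℓ) fun j => Nat.lcmUpto (P.modulus ℓ j) ^ τ (Sum.inr j),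
        mul_assoc, ← prod_mul_distrib]
      congr 1
      · exact prod_congr rfl fun j hj => by rw [hn]; simp only [if_pos hj, add_zero]
      · exact prod_congr rfl fun j hj => by
          rw [hn]
          simp only [if_neg (mem_compl.1 hj), pow_succ]
    rw [h1]
    ring
  rw [hprod]
  exact hdvd.trans (lcmTop_dvd_lcmTop _ hcardc)

/-! ### Crude forms: one modulus `D_m` -/

/-- The crude form of **[Nesterenko2008, Lemma 5]**: if every element of the set (12) is `≤ m`,
then `D_m^{Card S₂ - d(ℓ)} · B_{ℓ,d(ℓ)} ∈ ℤ`. [cite: Nesterenko2008, §2 Lemma 5 p. 281] -/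
theorem lemma5_pow [DecidableEq ι₁] (ℓ : ℤ) (hℓ : 1 ≤ P.d ℓ) {m : ℕ}
    (hm : ∀ i ∈ P.M ℓ, ∀ j ∉ P.M ℓ, P.pairMax i j ≤ m) :
    ∃ z : ℤ, ((Nat.lcmUpto m ^ (Fintype.card ι₂ - P.d ℓ) : ℕ) : ℚ) * P.B ℓ (P.d ℓ) = z := by
  obtain ⟨z, hz⟩ := P.lemma5 ℓ hℓ
  have hle : ∀ x ∈ P.N5 ℓ, x ≤ m := by
    intro x hx
    obtain ⟨q, hq, rfl⟩ := Multiset.mem_map.1 hx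
    rw [mem_val, mem_product, mem_compl] at hq
    exact hm q.1 hq.1 q.2 hq.2
  obtain ⟨c, hc⟩ := lcmTop_dvd_pow (P.N5 ℓ) hle (Fintype.card ι₂ - P.d ℓ)
  refine ⟨c * z, ?_⟩
  rw [hc]
  push_cast
  rw [mul_comm (lcmTop _ _ : ℚ) (c : ℚ), mul_assoc, hz]

/-- The crude form of **[Nesterenko2008, Lemma 6]** (the classical `D_m^{N}` bound, e.g.
`d_n^{a-k}` for `a` reciprocal bricks `n!/(t(t+1)⋯(t+n))` and numerators of degree `< n + 1`):
under `|Δ_i| < |Δ_j|` (`i ∈ S₁`, `j ∈ S₂`), if every element of `𝒩₂` is `≤ m` then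
`D_m^{Card S₂ - k} · B_{ℓ,k} ∈ ℤ` for `1 ≤ k ≤ d(ℓ)`. [cite: Nesterenko2008, §2 Lemma 6 p. 281] -/
theorem lemma6_pow [DecidableEq ι₁] (hΔ : ∀ i j, P.v i < P.w j) (ℓ : ℤ) (k : ℕ) (hk : 1 ≤ k)
    (hkd : k ≤ P.d ℓ) {m : ℕ} (hm : ∀ i j, i ≠ j → P.pairMax i j ≤ m) :
    ∃ z : ℤ, ((Nat.lcmUpto m ^ (Fintype.card ι₂ - k) : ℕ) : ℚ) * P.B ℓ k = z := by
  obtain ⟨z, hz⟩ := P.lemma6 hΔ ℓ k hk hkd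
  have hle : ∀ x ∈ P.N2, x ≤ m := by
    intro x hx
    obtain ⟨e, he, rfl⟩ := Multiset.mem_map.1 hx
    rw [mem_val, mem_powersetCard] at he
    obtain ⟨i, j, hij, rfl⟩ := card_eq_two.1 he.2
    rw [P.pairVal_pair hij]
    exact hm i j hij
  obtain ⟨c, hc⟩ := lcmTop_dvd_pow P.N2 hle (Fintype.card ι₂ - k)
  refine ⟨c * z, ?_⟩
  rw [hc]
  push_cast
  rw [mul_comm (lcmTop _ _ : ℚ) (c : ℚ), mul_assoc, hz]

/-! ### The `p`-adic order of `B_{ℓ,k}` (Zudilin's brackets, [Zudilin2004, Lemmas 17–18]) -/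

omit [Fintype ι₂] [DecidableEq ι₂] [Fintype ι₁] in
/-- Off its poles segment the regularised brick is literally `R(t)(t+k)`. [folklore] -/
private theorem recipBrickReg_eq_mul (a : ℤ) (m : ℕ) (k : ℤ) (hk : ¬(a ≤ k ∧ k < a + m)) (t : ℚ) :
    recipBrickReg a m k t = recipBrick a m t * (t + k) := by
  unfold recipBrickReg recipBrick
  rw [if_neg hk]
  have hall : (range m).filter (fun l : ℕ => a + (l : ℤ) ≠ k) = range m := by
    refine filter_true_of_mem fun l hl => ?_
    have := mem_range.1 hl
    omega
  rw [hall]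

/-- `Q̂_ℓ(s) = R(s)(s+ℓ)^{Card S₂}`: every reciprocal brick multiplied by `s + ℓ` (regularised on
`𝓜(ℓ)`), the form to which [Zudilin2004, Lemmas 17–18] apply factor by factor.
[cite: Zudilin2004, §7 Lemmas 17–18 and §8 (8.10)–(8.11)] -/
def Qfull (ℓ : ℤ) (t : ℚ) : ℚ :=
  (∏ i, polyBrick (P.b i) (P.v i) t) * ∏ j, recipBrickReg (P.a j) (P.w j) ℓ t

/-- `Q̂_ℓ(s) = (s+ℓ)^{Card S₂ - d(ℓ)} Q_ℓ(s)`. [cite: Zudilin2004, §8 (8.10)–(8.11)] -/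
theorem Qfull_eq (ℓ : ℤ) (t : ℚ) :
    P.Qfull ℓ t = (t + ℓ) ^ (Fintype.card ι₂ - P.d ℓ) * P.Q ℓ t := by
  unfold Qfull Q d
  rw [← prod_mul_prod_compl (P.M ℓ) fun j => recipBrickReg (P.a j) (P.w j) ℓ t]
  have h1 : ∏ j ∈ (P.M ℓ)ᶜ, recipBrickReg (P.a j) (P.w j) ℓ t =
      (∏ j ∈ (P.M ℓ)ᶜ, recipBrick (P.a j) (P.w j) t) * (t + ℓ) ^ (Fintype.card ι₂ - (P.M ℓ).card) := by
    rw [← card_compl, ← prod_const, ← prod_mul_distrib]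
    refine prod_congr rfl fun j hj => recipBrickReg_eq_mul (P.a j) (P.w j) ℓ ?_ t
    rw [mem_compl, mem_M] at hj
    exact hj
  rw [h1]
  ring

/-- `Q_ℓ` is smooth at `-ℓ`. [cite: Nesterenko2008, §2 (8) p. 277] -/
theorem contDiffAt_Q (ℓ : ℤ) (N : ℕ) : ContDiffAt ℚ N (P.Q ℓ) (-(ℓ : ℚ)) := by
  have h1 : ContDiffAt ℚ N (fun t => ∏ x, P.factor ℓ x t) (-(ℓ : ℚ)) :=
    (IsDInt.prod univ fun x _ => (P.factor_isDInt ℓ N x).of_dvd (dvd_zero _)).contDiffAt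
  have h2 : P.Q ℓ = fun t => ((P.C ℓ : ℚ))⁻¹ * ∏ x, P.factor ℓ x t :=
    funext fun t => P.Q_eq_prod_factor ℓ t
  rw [h2]
  exact contDiffAt_const.mul h1

/-- `B_{ℓ,k} = 𝒟_{Card S₂ - k} Q̂_ℓ(-ℓ)` for `k ≤ d(ℓ)` (shift by the zero of order
`Card S₂ - d(ℓ)` of `Q̂_ℓ` at `-ℓ`). [cite: Zudilin2004, §8 (8.10)–(8.11)] -/
theorem B_eq_divDeriv_Qfull (ℓ : ℤ) (k : ℕ) (hk : k ≤ P.d ℓ) :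
    P.B ℓ k = divDeriv (Fintype.card ι₂ - k) (P.Qfull ℓ) (-(ℓ : ℚ)) := by
  have hd : P.d ℓ ≤ Fintype.card ι₂ := card_le_univ _
  have h1 : P.Qfull ℓ = fun t => (t - (-(ℓ : ℚ))) ^ (Fintype.card ι₂ - P.d ℓ) * P.Q ℓ t := by
    funext t
    rw [P.Qfull_eq ℓ t, sub_neg_eq_add]
  rw [h1, divDeriv_sub_pow_mul (P.contDiffAt_Q ℓ _) (Fintype.card ι₂ - P.d ℓ),
    if_neg (by omega), B]
  congr 1
  omega

/-- Zudilin's bracket for a polynomial brick at `-ℓ` ([Zudilin2004, Lemma 17, (7.4)], with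
`a = b + v`): `⌊(b+v-1-ℓ)/p⌋ - ⌊(b-1-ℓ)/p⌋ - ⌊v/p⌋` (integer divisions).
[cite: Zudilin2004, §7 Lemma 17 (7.4)] -/
def ePoly (p : ℕ) (ℓ : ℤ) (i : ι₁) : ℤ :=
  (P.b i + P.v i - 1 - ℓ) / p - (P.b i - 1 - ℓ) / p - (P.v i : ℤ) / p

/-- Zudilin's bracket for a reciprocal brick at `-ℓ` ([Zudilin2004, Lemma 18, (7.7)], with
`b = a + w`): `⌊(w-1)/p⌋ - ⌊(ℓ-a)/p⌋ - ⌊(a+w-1-ℓ)/p⌋` (integer divisions).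
[cite: Zudilin2004, §7 Lemma 18 (7.7)] -/
def eRecip (p : ℕ) (ℓ : ℤ) (j : ι₂) : ℤ :=
  ((P.w j : ℤ) - 1) / p - (ℓ - P.a j) / p - (P.a j + P.w j - 1 - ℓ) / p

/-- **The `p`-adic order of the partial-fraction coefficients** (the generic form of
[Zudilin2004, (8.9)–(8.11)]: "`ord_p B ≥ ν_{k,p}`" assembled from Lemmas 17–18 brick by brick):
let `p` be a prime with `p² > v_i` for every polynomial brick, `p²` larger than the span of
`Δ_j ∪ {ℓ}` for every reciprocal brick, and `p > Card S₂ - k`. Then for `k ≤ d(ℓ)`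
`ord_p B_{ℓ,k} ≥ ∑_{i ∈ S₁} (⌊(b_i+v_i-1-ℓ)/p⌋ - ⌊(b_i-1-ℓ)/p⌋ - ⌊v_i/p⌋)
  + ∑_{j ∈ S₂} (⌊(w_j-1)/p⌋ - ⌊(ℓ-a_j)/p⌋ - ⌊(a_j+w_j-1-ℓ)/p⌋) - (Card S₂ - k)`.
Together with `lemma6` (whose `Card S₂ - k` factors `D_{q(i)}` each have `ord_p ≤ 1` for such
`p`) this is the source of Zudilin's `Φ`-savings for an arbitrary brick product.
[cite: Zudilin2004, §7 Lemmas 17–18 and §8 (8.9)–(8.11)] -/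
theorem padicOrdGe_B (p : ℕ) [Fact p.Prime] (ℓ : ℤ) (k : ℕ) (hk : k ≤ P.d ℓ)
    (hp₁ : ∀ i, P.v i < p ^ 2)
    (hp₂ : ∀ j, max (P.a j + P.w j - 1) ℓ - min (P.a j) ℓ < (p : ℤ) ^ 2)
    (hp₃ : Fintype.card ι₂ - k < p) :
    PadicOrdGe p ((∑ i, P.ePoly p ℓ i) + (∑ j, P.eRecip p ℓ j) - ((Fintype.card ι₂ - k : ℕ) : ℤ))
      (P.B ℓ k) := by
  set N := Fintype.card ι₂ - k with hN
  have h1 : IsDOrd p (∑ i, P.ePoly p ℓ i) N (fun t => ∏ i, polyBrick (P.b i) (P.v i) t)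
      (-(ℓ : ℚ)) :=
    IsDOrd.prod univ fun i _ => polyBrick_isDOrd p (P.b i) (P.v i) (hp₁ i) ℓ N
  have h2 : IsDOrd p (∑ j, P.eRecip p ℓ j) N (fun t => ∏ j, recipBrickReg (P.a j) (P.w j) ℓ t)
      (-(ℓ : ℚ)) := by
    refine IsDOrd.prod univ fun j _ => ?_
    have := recipBrickReg_isDOrd p (a₀ := min (P.a j) ℓ) (b₀ := max (P.a j + P.w j) (ℓ + 1))
      (P.one_le_w j) (min_le_left _ _) (le_max_left _ _) (min_le_right _ _)
      (lt_of_lt_of_le (lt_add_one ℓ) (le_max_right _ _)) (by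
        have := hp₂ j
        have e1 : max (P.a j + (P.w j : ℤ)) (ℓ + 1) = max (P.a j + P.w j - 1) ℓ + 1 := by
          rw [← max_add_add_right]; congr 1; ring
        rw [e1]
        omega) N
    exact this
  have h12 := h1.mul h2
  have hB := IsDOrd.padicOrdGe_divDeriv h12 hp₃ le_rfl
  rw [P.B_eq_divDeriv_Qfull ℓ k hk]
  exact hB

/-! ### The one-modulus bound for an ARBITRARY brick product -/

/-- **The crude bound without any hypothesis on the numerators** (what Lemmas 1, 3, 4 of
[Nesterenko2008] give with a single modulus, before any placement): for every brick product,
every `ℓ` and `k ≤ d(ℓ)` (also `k = 0`), and every `m` with `v_i ≤ m` (`i ∈ S₁`) and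
`max(ℓ - a_j, b_j - 1 - ℓ) ≤ m` (`j ∈ S₂`), one has `D_m^{Card S₂ - k} · B_{ℓ,k} ∈ ℤ`
(each Leibniz term needs `t_j` resp. `t_j + 1` moduli `≤ m`, `Card S₂ - k` in all, p. 282).
[cite: Nesterenko2008, §2 Lemmas 1, 3, 4 pp. 279–281 and proof of Lemma 6 p. 282] -/
theorem pow_mul_B_isInt [DecidableEq ι₁] (ℓ : ℤ) (k : ℕ) (hkd : k ≤ P.d ℓ) {m : ℕ}
    (hv : ∀ i, P.v i ≤ m) (hM : ∀ j, P.modulus ℓ j ≤ m) :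
    ∃ z : ℤ, ((Nat.lcmUpto m ^ (Fintype.card ι₂ - k) : ℕ) : ℚ) * P.B ℓ k = z := by
  apply P.isInt_mul_B
  intro τ hτ
  have hdle : P.d ℓ ≤ Fintype.card ι₂ := card_le_univ _
  -- every modulus divides `D_m`
  have hf : ∀ x, P.fmod ℓ x ∣ Nat.lcmUpto m := by
    rintro (i | j)
    · exact lcmUpto_dvd_lcmUpto (hv i)
    · exact lcmUpto_dvd_lcmUpto (hM j)
  have h1 : ∏ x, P.fmod ℓ x ^ τ x ∣ Nat.lcmUpto m ^ ∑ x, τ x := by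
    rw [← prod_pow_eq_pow_sum]
    exact prod_dvd_prod_of_dvd _ _ fun x _ => pow_dvd_pow_of_dvd (hf x) _
  have h2 : P.C ℓ ∣ Nat.lcmUpto m ^ (Fintype.card ι₂ - P.d ℓ) := by
    have hc : Fintype.card ι₂ - P.d ℓ = ((P.M ℓ)ᶜ).card := by rw [card_compl, d]
    rw [C, hc, ← prod_const]
    exact prod_dvd_prod_of_dvd _ _ fun j _ => lcmUpto_dvd_lcmUpto (hM j)
  refine (mul_dvd_mul h2 h1).trans ?_
  rw [← pow_add]
  exact pow_dvd_pow _ (by omega)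

/-! ### (1) ↔ (8): the `B_{ℓ,k}` ARE the partial-fraction coefficients -/

omit [Fintype ι₂] [DecidableEq ι₂] [Fintype ι₁] in
/-- Taylor coefficients of a local expansion: if `F(t) = ∑_{i=1}^{d} c_i (t-x)^{d-i} + (t-x)^d h(t)`
with `h` smooth at `x`, then `𝒟_{d-k} F(x) = c_k` for `1 ≤ k ≤ d`. [folklore] -/
private theorem divDeriv_expansion (x : ℚ) (d : ℕ) (c : ℕ → ℚ) (h : ℚ → ℚ)
    (hh : ∀ N : ℕ, ContDiffAt ℚ N h x) (k : ℕ) (hk1 : 1 ≤ k) (hkd : k ≤ d) :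
    divDeriv (d - k) (fun t => (∑ i ∈ Icc 1 d, c i * (t - x) ^ (d - i)) + (t - x) ^ d * h t) x
      = c k := by
  have hpoly : ∀ N : ℕ, ContDiffAt ℚ N (fun t => ∑ i ∈ Icc 1 d, c i * (t - x) ^ (d - i)) x :=
    fun N => ContDiffAt.sum fun i _ => contDiffAt_const.mul (contDiffAt_sub_pow x x (d - i))
  have hrest : ∀ N : ℕ, ContDiffAt ℚ N (fun t => (t - x) ^ d * h t) x :=
    fun N => (contDiffAt_sub_pow x x d).mul (hh N)
  rw [divDeriv_fun_add (hpoly _) (hrest _), divDeriv_sub_pow_mul (hh _) d, if_pos (by omega),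
    add_zero, divDeriv_sum fun i _ => contDiffAt_const.mul (contDiffAt_sub_pow x x (d - i))]
  simp_rw [divDeriv_const_mul, divDeriv_sub_pow]
  have : ∀ i ∈ Icc 1 d, c i * (if d - k = d - i then (1 : ℚ) else 0) = if k = i then c i else 0 := by
    intro i hi
    rw [mem_Icc] at hi
    by_cases hik : k = i
    · rw [if_pos (by omega), if_pos hik, mul_one]
    · rw [if_neg (by omega), if_neg hik, mul_zero]
  rw [sum_congr rfl this, sum_ite_eq]
  rw [if_pos (mem_Icc.2 ⟨hk1, hkd⟩)]

/-- **(1) ⇒ (8)** ([Nesterenko2008, p. 275 (1) and p. 277 (8)]: "For coefficients `B_{ℓ,k}` we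
have the expression (8)"): if `R` has ANY expansion
`R(t) = ∑_{ℓ' ∈ L} ∑_{k=1}^{e(ℓ')} c_{ℓ',k} (t+ℓ')^{-k} + h(t)` off the points `-ℓ'` (`ℓ' ∈ L`),
with `h` smooth at `-ℓ` (e.g. a polynomial), `ℓ ∈ L` and `e(ℓ) = d(ℓ)`, then its coefficients at
`-ℓ` are the `B_{ℓ,k}` of (8): `B_{ℓ,k} = c_{ℓ,k}` (`1 ≤ k ≤ d(ℓ)`). So `lemma5`, `lemma6` and
`padicOrdGe_B` apply to the coefficients of any partial-fraction decomposition of `R`.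
[cite: Nesterenko2008, §1 (1) p. 275 and §2 (8) p. 277] -/
theorem B_eq_of_partialFractions (L : Finset ℤ) (e : ℤ → ℕ) (c : ℤ → ℕ → ℚ) (h : ℚ → ℚ)
    (ℓ : ℤ) (hℓ : ℓ ∈ L) (he : e ℓ = P.d ℓ) (hh : ∀ N : ℕ, ContDiffAt ℚ N h (-(ℓ : ℚ)))
    (hR : ∀ t : ℚ, (∀ ℓ' ∈ L, t + ℓ' ≠ 0) →
      P.R t = (∑ ℓ' ∈ L, ∑ k ∈ Icc 1 (e ℓ'), c ℓ' k * ((t + ℓ') ^ k)⁻¹) + h t)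
    (k : ℕ) (hk1 : 1 ≤ k) (hkd : k ≤ P.d ℓ) :
    P.B ℓ k = c ℓ k := by
  set x : ℚ := -(ℓ : ℚ) with hx
  set d := P.d ℓ with hd
  -- the part of the expansion regular at `-ℓ`
  set g : ℚ → ℚ := fun t =>
    (∑ ℓ' ∈ L.erase ℓ, ∑ k ∈ Icc 1 (e ℓ'), c ℓ' k * ((t + ℓ') ^ k)⁻¹) + h t with hg
  have hne : ∀ ℓ' ∈ L.erase ℓ, x + (ℓ' : ℚ) ≠ 0 := by
    intro ℓ' hℓ'
    have h1 : ℓ' ≠ ℓ := ne_of_mem_erase hℓ'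
    rw [hx, show (-(ℓ : ℚ) + ℓ') = ((ℓ' - ℓ : ℤ) : ℚ) by push_cast; ring]
    exact_mod_cast sub_ne_zero.2 h1
  have hgs : ∀ N : ℕ, ContDiffAt ℚ N g x := by
    intro N
    refine ContDiffAt.add (ContDiffAt.sum fun ℓ' hℓ' => ContDiffAt.sum fun k _ => ?_) (hh N)
    refine contDiffAt_const.mul ?_
    have : (fun t : ℚ => ((t + (ℓ' : ℚ)) ^ k)⁻¹) = fun t : ℚ => ((t + (ℓ' : ℚ))⁻¹) ^ k := by
      funext t; rw [inv_pow]
    rw [this]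
    exact (contDiffAt_inv_add_const (hne ℓ' hℓ')).pow k
  -- the local model of `Q_ℓ`
  set G : ℚ → ℚ := fun t => (∑ i ∈ Icc 1 d, c ℓ i * (t - x) ^ (d - i)) + (t - x) ^ d * g t
    with hG
  have hpunct : ∀ᶠ t : ℚ in 𝓝[≠] x, P.Q ℓ t = G t := by
    -- a punctured neighbourhood of `-ℓ` avoiding all `-ℓ'`
    have h1 : ∀ᶠ t : ℚ in 𝓝[≠] x, t ≠ x := self_mem_nhdsWithin
    have h2 : ∀ᶠ t : ℚ in 𝓝 x, ∀ ℓ' ∈ L.erase ℓ, t + (ℓ' : ℚ) ≠ 0 :=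
      (eventually_all_finset (L.erase ℓ)).2 fun ℓ' hℓ' =>
        (continuous_id.add continuous_const).continuousAt.eventually_ne (hne ℓ' hℓ')
    filter_upwards [h1, mem_nhdsWithin_of_mem_nhds h2] with t ht1 ht2
    have htℓ : t + ℓ ≠ 0 := fun h0 => ht1 (by rw [hx]; linarith)
    have hall : ∀ ℓ' ∈ L, t + ℓ' ≠ 0 := by
      intro ℓ' hℓ'
      by_cases h' : ℓ' = ℓ
      · rw [h']; exact htℓ
      · exact ht2 ℓ' (mem_erase.2 ⟨h', hℓ'⟩)
    rw [P.Q_eq ℓ htℓ, hR t hall, ← add_sum_erase L _ hℓ, hG, hg, he]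
    simp only
    have htx : t - x = t + ℓ := by rw [hx, sub_neg_eq_add]
    rw [htx, add_assoc, add_mul, sum_mul]
    congr 1
    · refine sum_congr rfl fun i hi => ?_
      rw [mem_Icc] at hi
      rw [mul_assoc, ← hd, pow_sub₀ _ htℓ hi.2, mul_comm ((t + (ℓ : ℚ)) ^ d)]
    · ring
  have hQG : P.Q ℓ =ᶠ[𝓝 x] G := by
    refine eventuallyEq_of_nhdsNE (P.contDiffAt_Q ℓ 0).continuousAt ?_ hpunct
    have : ContDiffAt ℚ 0 G x :=
      (ContDiffAt.sum fun i _ => contDiffAt_const.mul (contDiffAt_sub_pow x x (d - i))).add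
        ((contDiffAt_sub_pow x x d).mul (hgs 0))
    exact this.continuousAt
  rw [B, ← hd, divDeriv_congr hQG]
  exact divDeriv_expansion x d (c ℓ) g hgs k hk1 hkd

end Fin₂

end BrickProduct

end Nesterenko2008

end Literature.NumberTheory.Transcendental
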